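import Literature.AnabelianGeometry.SemiGraphs.UniversalCoveringOverOrbitGraph
import Literature.AnabelianGeometry.SemiGraphs.UniversalCoveringOverGalois
import HarnessLib

/-!
# `π₁^temp` on the trees and the finite levels: functoriality in the covering ([SemiAnbd] §3 pp. 38, 41)

Mochizuki, *Semi-graphs of anabelioids*, Publ. RIMS **42** (2006), §3: proof of Prop. 3.6, author's
manuscript p. 38 [cite: MochizukiSemiAnbd2006, Prop 3.6 p.38] ("we may choose compatible maps
`𝒢_{∞,j} → 𝒢_{∞,i}`, hence `Gal(𝒢_{∞,j}/𝒢) → Gal(𝒢_{∞,i}/𝒢)`") and proof of Thm. 3.7 (iii), p. 41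
[cite: MochizukiSemiAnbd2006, Thm 3.7(iii) p.41] (`π₁^temp(𝒢)` "acts on each of the `𝒢_{∞,i}`";
"for `i ≥ j` we have natural maps `V_i → V_j`, `E_i → E_j`"; the finite semi-graphs `𝔾_j`).

Sequel to `UniversalCoveringOverOrbitGraph.lean` ((B5): `𝔾_{𝒢_{∞,S}} ≅ 𝔾̃_S`, the action
`autUnivCover : Aut(𝒢_{∞,S}) →* Aut(𝔾̃_S)`) and `UniversalCoveringOverGalois.lean` ((B5b): the descent
`descendBaseAut : Aut(𝒢_{∞,S}) →* Aut(𝒢_S)`).  It supplies the remaining tree-level shapes of the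
interface `TemperedLevelData.lean` (`trans`, `trans_quot`, `levelAct`, `act_quot`, `trans_act`) over the
constructed objects:

* `SemiGraph.univCoverMap φ c₀ : 𝔾̃ → 𝔾̃'` — functoriality of the universal graph-covering in the
  semi-graph (`(v, p) ↦ (φ v, φ_* p)`), over `φ` (`univCoverMap_comp_proj`), compatible with the deck
  transformations (`deck_comp_univCoverMap`);
* `CovObj.orbitGraphMap_univCoverOverMap_comp` — NATURALITY IN `S` of the identification (B5): under
  `𝔾_{𝒢_{∞,T}} ≅ 𝔾̃_T`, `𝔾_{𝒢_{∞,S}} ≅ 𝔾̃_S`, the morphism `𝒢_{∞,T} → 𝒢_{∞,S}` induced by `f : T ⟶ S`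
  (`univCoverOverMap`, abc-iut-L3-t9) becomes `univCoverMap f̄` (the `trans` / `trans_quot` shape);
* `CovObj.treeMap f c` (= `univCoverMap f̄ c`), `CovObj.autUnivCover_hom_comp_treeMap` — equivariance for any pair of
  automorphisms `σ`, `σ'` intertwined by `𝒢_{∞,T} → 𝒢_{∞,S}` (the `trans_act` shape);
* `CovObj.levelAut : Aut(𝒢_{∞,S}) →* Aut(𝔾_S)` — the action on the finite level (`levelAct`), with
  `CovObj.autUnivCover_hom_comp_univCoverProj` (the `act_quot` square for `quot := 𝔾̃_S → 𝔾_S`),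
  `levelAut_deckOverAut` (deck transformations act trivially on `𝔾_S`) and
  `levelAut_hom_comp_orbitGraphMap` (the `levelTrans_act` square);
* base-point bookkeeping across an `eqToIso` (`autUnivCover_conjAut_eqToIso`, …).

Seat abc-iut-L3-t6 (row «(B5c) LEVELS»). Nothing here bears on [IUTchIII] Cor. 3.12.
-/

namespace Literature.AnabelianGeometry.SemiGraphs

open CategoryTheory

universe u

/-! ### Functoriality of the universal graph-covering in the semi-graph -/

namespace SemiGraph

variable {G G' : SemiGraph.{u}} (φ : G ⟶ G') (c₀ : G.CatCarrier)

/-- A morphism of semi-graphs maps the arrow of a branch to the arrow of the image branch, on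
fundamental groupoids. [cite: MochizukiSemiAnbd2006, §1 p.15] -/
theorem Hom.mapFundamentalGroupoid_brArrow (b : G.Branch) (e : G.Edge) (v : G.Vertex)
    (he : G.edgeOf b = e) (hv : G.abuts b = some v) :
    (Hom.mapFundamentalGroupoid φ).map (G.brArrow b e v he hv) =
      G'.brArrow (φ.branchMap b) (φ.edgeMap e) (φ.vertexMap v) (by rw [φ.edgeOf_branchMap, he])
        (φ.abuts_branchMap b v hv) := by
  change 𝟙 _ ≫ _ = _
  exact Category.id_comp _

/-- **Functoriality of the universal graph-covering**: a morphism `φ : 𝔾 → 𝔾'` induces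
`𝔾̃ → 𝔾̃'` (based at `c₀` and `φ c₀`), `(v, p) ↦ (φ v, φ_* p)`. [cite: MochizukiSemiAnbd2006, §1 p.15] -/
noncomputable def univCoverMap : G.univCover c₀ ⟶ G'.univCover ((Hom.catPrefunctor φ).obj c₀) where
  vertexMap vt := ⟨φ.vertexMap vt.1, (Hom.mapFundamentalGroupoid φ).map vt.2⟩
  edgeMap et := ⟨φ.edgeMap et.1, (Hom.mapFundamentalGroupoid φ).map et.2⟩
  branchMap bt := ⟨⟨φ.edgeMap bt.1.1, (Hom.mapFundamentalGroupoid φ).map bt.1.2⟩,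
    ⟨φ.branchMap bt.2.1, by rw [φ.edgeOf_branchMap, bt.2.2]⟩⟩
  edgeOf_branchMap _ := rfl
  branchMap_injOn := by
    rintro ⟨et₁, ⟨b₁, hb₁⟩⟩ ⟨et₂, ⟨b₂, hb₂⟩⟩ (he : et₁ = et₂) h
    subst he
    have hb : φ.branchMap b₁ = φ.branchMap b₂ :=
      congrArg (fun bt : (G'.univCover ((Hom.catPrefunctor φ).obj c₀)).Branch => bt.2.1) h
    have := φ.branchMap_injOn b₁ b₂ (hb₁.trans hb₂.symm) hb
    subst this
    rfl
  abuts_branchMap := by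
    rintro ⟨⟨e, p⟩, ⟨b, hb⟩⟩ ⟨v, q⟩ h
    have hv := (G.univCoverProj c₀).abuts_branchMap _ _ h
    change G.abuts b = some v at hv
    rw [G.univCover_abuts_of_abuts c₀ e p b hb v hv] at h
    have hq := eq_of_heq (Sigma.mk.inj_iff.mp (Option.some.inj h)).2
    subst hq
    change (G'.univCover _).abuts ⟨⟨φ.edgeMap e, _⟩, ⟨φ.branchMap b, _⟩⟩ =
      some ⟨φ.vertexMap v, (Hom.mapFundamentalGroupoid φ).map (p ≫ G.brArrow b e v hb hv)⟩
    rw [G'.univCover_abuts_of_abuts _ (φ.edgeMap e) _ (φ.branchMap b) _ (φ.vertexMap v)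
      (φ.abuts_branchMap b v hv), Functor.map_comp, Hom.mapFundamentalGroupoid_brArrow]
    rfl

/-- `univCoverMap φ` lies over `φ`. [cite: MochizukiSemiAnbd2006, §1 p.15] -/
theorem univCoverMap_comp_proj :
    univCoverMap φ c₀ ≫ G'.univCoverProj _ = G.univCoverProj c₀ ≫ φ :=
  SemiGraph.hom_ext _ _ rfl rfl rfl

/-- `univCoverMap φ` intertwines the deck transformation of `γ` with that of `φ_* γ`.
[cite: MochizukiSemiAnbd2006, §1 p.15] -/
theorem deck_comp_univCoverMap (γ : G.FundamentalGroup c₀) :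
    G.deck c₀ γ ≫ univCoverMap φ c₀ =
      univCoverMap φ c₀ ≫ G'.deck _ ((Hom.mapFundamentalGroupoid φ).map γ) := by
  have hinv : (Hom.mapFundamentalGroupoid φ).map (inv γ) = inv ((Hom.mapFundamentalGroupoid φ).map γ) :=
    Functor.map_inv _ _
  refine SemiGraph.hom_ext _ _ (funext fun vt => ?_) (funext fun et => ?_) (funext fun bt => ?_)
  · change (⟨φ.vertexMap vt.1, (Hom.mapFundamentalGroupoid φ).map (inv γ ≫ vt.2)⟩ :
        (G'.univCover _).Vertex) = ⟨φ.vertexMap vt.1, inv _ ≫ _⟩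
    rw [Functor.map_comp, hinv]
    rfl
  · change (⟨φ.edgeMap et.1, (Hom.mapFundamentalGroupoid φ).map (inv γ ≫ et.2)⟩ :
        (G'.univCover _).Edge) = ⟨φ.edgeMap et.1, inv _ ≫ _⟩
    rw [Functor.map_comp, hinv]
    rfl
  · change (⟨⟨φ.edgeMap bt.1.1, (Hom.mapFundamentalGroupoid φ).map (inv γ ≫ bt.1.2)⟩, _⟩ :
        (G'.univCover _).Branch) = ⟨⟨φ.edgeMap bt.1.1, inv _ ≫ _⟩, _⟩
    rw [Functor.map_comp, hinv]
    rfl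

end SemiGraph

namespace ProfiniteSemiGraph

variable {𝒢 : ProfiniteSemiGraph.{u}}

/-- The underlying-semi-graph functor on objects (unfolding lemma for consumers).
[cite: MochizukiSemiAnbd2006, Def 3.5(i) p.37] -/
@[simp] theorem orbitGraphFunctor_obj (T : CovObj 𝒢) : (orbitGraphFunctor 𝒢).obj T = T.orbitGraph := rfl

/-- The underlying-semi-graph functor on morphisms (unfolding lemma for consumers).
[cite: MochizukiSemiAnbd2006, Def 3.5(i) p.37] -/
@[simp] theorem orbitGraphFunctor_map {T S : CovObj 𝒢} (f : T ⟶ S) :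
    (orbitGraphFunctor 𝒢).map f = CovObj.orbitGraphMap f := rfl

/-! ### Naturality of `𝔾_{𝒢_{∞,S}} ≅ 𝔾̃_S` in the covering -/

section Naturality

variable {T S : CovObj 𝒢} (f : T ⟶ S) (c : T.orbitGraph.CatCarrier) (h𝒢 : 𝒢.IsCountable)

/-- **The morphism of trees `𝔾̃_T → 𝔾̃_S` induced by `f : T ⟶ S`** (based at `c` and `f̄ c`):
`univCoverMap` of `f̄ : 𝔾_T → 𝔾_S` (the `trans` shape; "natural maps `V_i → V_j`, `E_i → E_j`",
p. 41). [cite: MochizukiSemiAnbd2006, Thm 3.7(iii) p.41] -/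
noncomputable def CovObj.treeMap :
    T.orbitGraph.univCover c ⟶ S.orbitGraph.univCover (CovObj.baseMap f c) :=
  SemiGraph.univCoverMap (CovObj.orbitGraphMap f) c

/-- `treeMap` unfolded. [cite: MochizukiSemiAnbd2006, Thm 3.7(iii) p.41] -/
theorem CovObj.treeMap_def :
    CovObj.treeMap f c = SemiGraph.univCoverMap (CovObj.orbitGraphMap f) c := rfl

/-- `treeMap f` lies over `f̄ : 𝔾_T → 𝔾_S` (the `trans_quot` shape).
[cite: MochizukiSemiAnbd2006, Thm 3.7(iii) p.41] -/
theorem CovObj.treeMap_comp_univCoverProj :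
    CovObj.treeMap f c ≫ S.orbitGraph.univCoverProj (CovObj.baseMap f c) =
      T.orbitGraph.univCoverProj c ≫ CovObj.orbitGraphMap f :=
  SemiGraph.univCoverMap_comp_proj _ _

/-- `treeMap f` lies over `𝔾` (the `trans_over` shape). [cite: MochizukiSemiAnbd2006, Thm 3.7(iii) p.41] -/
theorem CovObj.treeMap_comp_proj :
    CovObj.treeMap f c ≫ S.orbitGraph.univCoverProj (CovObj.baseMap f c) ≫ S.orbitGraphProj =
      T.orbitGraph.univCoverProj c ≫ T.orbitGraphProj := by
  rw [← Category.assoc, CovObj.treeMap_comp_univCoverProj, Category.assoc,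
    CovObj.orbitGraphMap_comp_proj]

/-- `treeMap f` intertwines the deck transformations of `γ ∈ π₁(𝔾_T, c)` and `f̄_* γ`.
[cite: MochizukiSemiAnbd2006, Thm 3.7(iii) p.41] -/
theorem CovObj.deck_comp_treeMap (γ : T.orbitGraph.FundamentalGroup c) :
    T.orbitGraph.deck c γ ≫ CovObj.treeMap f c =
      CovObj.treeMap f c ≫ S.orbitGraph.deck (CovObj.baseMap f c) (CovObj.pathMap f γ) :=
  SemiGraph.deck_comp_univCoverMap _ _ γ

/-- **Naturality in `S` of the identification (B5)**: the morphism of underlying semi-graphs of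
`𝒢_{∞,T} → 𝒢_{∞,S}` (induced by `f : T ⟶ S`) is, under `𝔾_{𝒢_{∞,T}} ≅ 𝔾̃_T` and `𝔾_{𝒢_{∞,S}} ≅ 𝔾̃_S`,
the morphism of trees `𝔾̃_T → 𝔾̃_S` induced by `f̄ : 𝔾_T → 𝔾_S` ("compatible maps `𝒢_{∞,j} → 𝒢_{∞,i}`",
p. 38; "natural maps `V_i → V_j`, `E_i → E_j`", p. 41). [cite: MochizukiSemiAnbd2006, Thm 3.7(iii) p.41] -/
theorem CovObj.orbitGraphMap_univCoverOverMap_comp :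
    CovObj.orbitGraphMap (CovObj.univCoverOverMap f c h𝒢) ≫
        S.univCoverOverToUnivCover (CovObj.baseMap f c) h𝒢 =
      T.univCoverOverToUnivCover c h𝒢 ≫ CovObj.treeMap f c := by
  refine SemiGraph.hom_ext _ _ (funext fun V => ?_) (funext fun E => ?_) (funext fun β => ?_)
  · obtain ⟨⟨v, t⟩, rfl⟩ := Quot.exists_rep V
    rfl
  · obtain ⟨⟨e, t⟩, rfl⟩ := Quot.exists_rep E
    rfl
  · obtain ⟨⟨b, E⟩, hE⟩ := β
    obtain ⟨⟨e, t⟩, rfl⟩ := Quot.exists_rep E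
    rfl

/-- The same with the isomorphisms: `iso_T⁻¹ ≫ 𝔾(𝒢_{∞,T} → 𝒢_{∞,S}) = (𝔾̃_T → 𝔾̃_S) ≫ iso_S⁻¹`.
[cite: MochizukiSemiAnbd2006, Thm 3.7(iii) p.41] -/
theorem CovObj.univCoverOverOrbitGraphIso_inv_comp_orbitGraphMap :
    (T.univCoverOverOrbitGraphIso c h𝒢).inv ≫ CovObj.orbitGraphMap (CovObj.univCoverOverMap f c h𝒢) =
      CovObj.treeMap f c ≫ (S.univCoverOverOrbitGraphIso (CovObj.baseMap f c) h𝒢).inv := by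
  rw [Iso.inv_comp_eq, ← Category.assoc, Iso.eq_comp_inv]
  exact CovObj.orbitGraphMap_univCoverOverMap_comp f c h𝒢

/-- **Equivariance of the transition maps of the trees** (the `trans_act` shape): if automorphisms
`σ` of `𝒢_{∞,T}` and `σ'` of `𝒢_{∞,S}` are intertwined by `𝒢_{∞,T} → 𝒢_{∞,S}`, the automorphisms of
the trees `𝔾̃_T`, `𝔾̃_S` they induce are intertwined by `𝔾̃_T → 𝔾̃_S`.
[cite: MochizukiSemiAnbd2006, Thm 3.7(iii) p.41] -/
theorem CovObj.autUnivCover_hom_comp_treeMap (σ : Aut (T.univCoverOver c h𝒢))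
    (σ' : Aut (S.univCoverOver (CovObj.baseMap f c) h𝒢))
    (hσ : σ.hom ≫ CovObj.univCoverOverMap f c h𝒢 = CovObj.univCoverOverMap f c h𝒢 ≫ σ'.hom) :
    (T.autUnivCover c h𝒢 σ).hom ≫ CovObj.treeMap f c =
      CovObj.treeMap f c ≫ (S.autUnivCover (CovObj.baseMap f c) h𝒢 σ').hom := by
  have h1 : ∀ {Z : SemiGraph.{u}} (k : (S.univCoverOver (CovObj.baseMap f c) h𝒢).orbitGraph ⟶ Z),
      CovObj.orbitGraphMap σ.hom ≫ CovObj.orbitGraphMap (CovObj.univCoverOverMap f c h𝒢) ≫ k =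
        CovObj.orbitGraphMap (CovObj.univCoverOverMap f c h𝒢) ≫ CovObj.orbitGraphMap σ'.hom ≫ k :=
    fun k => by
      rw [← Category.assoc, ← CovObj.orbitGraphMap_comp, hσ, CovObj.orbitGraphMap_comp, Category.assoc]
  have h2 := CovObj.orbitGraphMap_univCoverOverMap_comp f c h𝒢
  have h3 : ∀ {Z : SemiGraph.{u}} (k : (S.univCoverOver (CovObj.baseMap f c) h𝒢).orbitGraph ⟶ Z),
      (T.univCoverOverOrbitGraphIso c h𝒢).inv ≫
          CovObj.orbitGraphMap (CovObj.univCoverOverMap f c h𝒢) ≫ k =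
        CovObj.treeMap f c ≫ (S.univCoverOverOrbitGraphIso (CovObj.baseMap f c) h𝒢).inv ≫ k :=
    fun k => by
      rw [← Category.assoc, CovObj.univCoverOverOrbitGraphIso_inv_comp_orbitGraphMap f c h𝒢,
        Category.assoc]
  simp only [CovObj.autUnivCover_hom, Category.assoc, ← h2, h1, h3]

end Naturality

/-! ### The action on the finite level `𝔾_S` -/

section Levels

variable (S : CovObj 𝒢) (h𝒢 : 𝒢.IsCountable) (V₀ : S.OVertex)
  (htrans : ∀ (v : 𝒢.graph.Vertex) (x x' : (S.SV v).obj.V), ∃ σ : S ⟶ S, (σ.fV v).hom.hom x = x')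
  (hconn : ∀ p q : S.Point, S.SameComponent p q)

/-- **The action `Aut(𝒢_{∞,S}) →* Aut(𝔾_S)` on the underlying semi-graph of the finite level** (the
`levelAct` shape: descend to `S`, then take the underlying semi-graph).
[cite: MochizukiSemiAnbd2006, Thm 3.7(iii) p.41] -/
noncomputable def CovObj.levelAut : Aut (S.univCoverOver (Sum.inl V₀) h𝒢) →* Aut S.orbitGraph :=
  ((orbitGraphFunctor 𝒢).mapAut S).comp (S.descendBaseAut h𝒢 V₀ htrans hconn)

/-- `levelAut` on `hom`s. [cite: MochizukiSemiAnbd2006, Thm 3.7(iii) p.41] -/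
theorem CovObj.levelAut_hom (σ : Aut (S.univCoverOver (Sum.inl V₀) h𝒢)) :
    (S.levelAut h𝒢 V₀ htrans hconn σ).hom =
      CovObj.orbitGraphMap (S.descendBase h𝒢 V₀ htrans σ.hom) := rfl

/-- The action on `𝔾_S` lies over `𝔾`. [cite: MochizukiSemiAnbd2006, Thm 3.7(iii) p.41] -/
theorem CovObj.levelAut_hom_comp_proj (σ : Aut (S.univCoverOver (Sum.inl V₀) h𝒢)) :
    (S.levelAut h𝒢 V₀ htrans hconn σ).hom ≫ S.orbitGraphProj = S.orbitGraphProj :=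
  CovObj.orbitGraphMap_comp_proj _

/-- **The `act_quot` square**: the action of `σ ∈ Aut(𝒢_{∞,S})` on the tree `𝔾̃_S` covers its action on
the finite level `𝔾_S` through `𝔾̃_S → 𝔾_S`. [cite: MochizukiSemiAnbd2006, Thm 3.7(iii) p.41] -/
theorem CovObj.autUnivCover_hom_comp_univCoverProj (σ : Aut (S.univCoverOver (Sum.inl V₀) h𝒢)) :
    (S.autUnivCover (Sum.inl V₀) h𝒢 σ).hom ≫ S.orbitGraph.univCoverProj (Sum.inl V₀) =
      S.orbitGraph.univCoverProj (Sum.inl V₀) ≫ (S.levelAut h𝒢 V₀ htrans hconn σ).hom := by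
  rw [S.autUnivCover_hom]
  simp only [Category.assoc]
  rw [S.univCoverOverToUnivCover_comp_univCoverProj, ← CovObj.orbitGraphMap_comp,
    S.aut_hom_comp_univCoverOverProj h𝒢 V₀ htrans hconn σ, CovObj.orbitGraphMap_comp,
    ← S.univCoverOverToUnivCover_comp_univCoverProj (Sum.inl V₀) h𝒢]
  simp only [Category.assoc, ← CovObj.univCoverOverOrbitGraphIso_hom, Iso.inv_hom_id_assoc]
  rfl

/-- Deck transformations act trivially on the finite level. [cite: MochizukiSemiAnbd2006, Prop 3.6 p.38] -/
theorem CovObj.levelAut_deckOverAut (γ : S.orbitGraph.FundamentalGroup (Sum.inl V₀)) :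
    S.levelAut h𝒢 V₀ htrans hconn (S.deckOverAut (Sum.inl V₀) h𝒢 γ) = 1 := by
  change (orbitGraphFunctor 𝒢).mapAut S
    (S.descendBaseAut h𝒢 V₀ htrans hconn (S.deckOverAut (Sum.inl V₀) h𝒢 γ)) = 1
  rw [S.descendBaseAut_deckOverAut h𝒢 V₀ htrans hconn γ, map_one]

/-- **Naturality of the descent in the covering** (the `levelTrans_act` shape, on `S`): for `f : T ⟶ S`
and endomorphisms `σ` of `𝒢_{∞,T}`, `σ'` of `𝒢_{∞,S}` intertwined by `𝒢_{∞,T} → 𝒢_{∞,S}`, the descended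
endomorphisms of `T` and `S` are intertwined by `f` (precompose with the fibre-surjective `𝒢_{∞,T} → 𝒢_T`).
[cite: MochizukiSemiAnbd2006, Thm 3.7(iii) p.41] -/
theorem CovObj.descendBase_comp_eq_comp_descendBase {T : CovObj 𝒢} (f : T ⟶ S) (W : T.OVertex)
    (htransT : ∀ (v : 𝒢.graph.Vertex) (x x' : (T.SV v).obj.V), ∃ σ : T ⟶ T, (σ.fV v).hom.hom x = x')
    (hconnT : ∀ p q : T.Point, T.SameComponent p q)
    (htransS : ∀ (v : 𝒢.graph.Vertex) (x x' : (S.SV v).obj.V), ∃ σ : S ⟶ S, (σ.fV v).hom.hom x = x')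
    (σ : T.univCoverOver (Sum.inl W) h𝒢 ⟶ T.univCoverOver (Sum.inl W) h𝒢)
    (σ' : S.univCoverOver (Sum.inl (CovObj.OVertex.map f W)) h𝒢 ⟶
      S.univCoverOver (Sum.inl (CovObj.OVertex.map f W)) h𝒢)
    (hσ : σ ≫ CovObj.univCoverOverMap f (Sum.inl W) h𝒢 = CovObj.univCoverOverMap f (Sum.inl W) h𝒢 ≫ σ') :
    T.descendBase h𝒢 W htransT σ ≫ f = f ≫ S.descendBase h𝒢 (CovObj.OVertex.map f W) htransS σ' := by
  refine T.hom_ext_of_univCoverOverProj_comp h𝒢 W hconnT _ _ ?_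
  calc T.univCoverOverProj (Sum.inl W) h𝒢 ≫ T.descendBase h𝒢 W htransT σ ≫ f
      = (T.univCoverOverProj (Sum.inl W) h𝒢 ≫ T.descendBase h𝒢 W htransT σ) ≫ f :=
        (Category.assoc _ _ _).symm
    _ = (σ ≫ T.univCoverOverProj (Sum.inl W) h𝒢) ≫ f :=
        congrArg (· ≫ f) (T.comp_univCoverOverProj_eq h𝒢 W htransT σ).symm
    _ = σ ≫ (T.univCoverOverProj (Sum.inl W) h𝒢 ≫ f) := Category.assoc _ _ _
    _ = σ ≫ (CovObj.univCoverOverMap f (Sum.inl W) h𝒢 ≫ S.univCoverOverProj _ h𝒢) :=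
        congrArg (σ ≫ ·) (CovObj.univCoverOverMap_comp_proj f (Sum.inl W) h𝒢).symm
    _ = (σ ≫ CovObj.univCoverOverMap f (Sum.inl W) h𝒢) ≫ S.univCoverOverProj _ h𝒢 :=
        (Category.assoc _ _ _).symm
    _ = (CovObj.univCoverOverMap f (Sum.inl W) h𝒢 ≫ σ') ≫ S.univCoverOverProj _ h𝒢 :=
        congrArg (· ≫ S.univCoverOverProj _ h𝒢) hσ
    _ = CovObj.univCoverOverMap f (Sum.inl W) h𝒢 ≫ (σ' ≫ S.univCoverOverProj _ h𝒢) :=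
        Category.assoc _ _ _
    _ = CovObj.univCoverOverMap f (Sum.inl W) h𝒢 ≫ (S.univCoverOverProj _ h𝒢 ≫
          S.descendBase h𝒢 (CovObj.OVertex.map f W) htransS σ') :=
        congrArg (CovObj.univCoverOverMap f (Sum.inl W) h𝒢 ≫ ·)
          (S.comp_univCoverOverProj_eq h𝒢 (CovObj.OVertex.map f W) htransS σ')
    _ = (CovObj.univCoverOverMap f (Sum.inl W) h𝒢 ≫ S.univCoverOverProj _ h𝒢) ≫
          S.descendBase h𝒢 (CovObj.OVertex.map f W) htransS σ' :=
        (Category.assoc _ _ _).symm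
    _ = (T.univCoverOverProj (Sum.inl W) h𝒢 ≫ f) ≫
          S.descendBase h𝒢 (CovObj.OVertex.map f W) htransS σ' :=
        congrArg (· ≫ S.descendBase h𝒢 (CovObj.OVertex.map f W) htransS σ')
          (CovObj.univCoverOverMap_comp_proj f (Sum.inl W) h𝒢)
    _ = T.univCoverOverProj (Sum.inl W) h𝒢 ≫ f ≫
          S.descendBase h𝒢 (CovObj.OVertex.map f W) htransS σ' := Category.assoc _ _ _

/-- **Equivariance of `f̄ : 𝔾_T → 𝔾_S` for the actions on the finite levels** (the `levelTrans_act` shape):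
if `σ ∈ Aut(𝒢_{∞,T})` and `σ' ∈ Aut(𝒢_{∞,S})` are intertwined by `𝒢_{∞,T} → 𝒢_{∞,S}`, their actions on
`𝔾_T`, `𝔾_S` are intertwined by `f̄`. [cite: MochizukiSemiAnbd2006, Thm 3.7(iii) p.41] -/
theorem CovObj.levelAut_hom_comp_orbitGraphMap {T : CovObj 𝒢} (f : T ⟶ S) (W : T.OVertex)
    (htransT : ∀ (v : 𝒢.graph.Vertex) (x x' : (T.SV v).obj.V), ∃ σ : T ⟶ T, (σ.fV v).hom.hom x = x')
    (hconnT : ∀ p q : T.Point, T.SameComponent p q)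
    (htransS : ∀ (v : 𝒢.graph.Vertex) (x x' : (S.SV v).obj.V), ∃ σ : S ⟶ S, (σ.fV v).hom.hom x = x')
    (hconnS : ∀ p q : S.Point, S.SameComponent p q)
    (σ : Aut (T.univCoverOver (Sum.inl W) h𝒢))
    (σ' : Aut (S.univCoverOver (Sum.inl (CovObj.OVertex.map f W)) h𝒢))
    (hσ : σ.hom ≫ CovObj.univCoverOverMap f (Sum.inl W) h𝒢 =
      CovObj.univCoverOverMap f (Sum.inl W) h𝒢 ≫ σ'.hom) :
    (T.levelAut h𝒢 W htransT hconnT σ).hom ≫ CovObj.orbitGraphMap f =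
      CovObj.orbitGraphMap f ≫ (S.levelAut h𝒢 (CovObj.OVertex.map f W) htransS hconnS σ').hom := by
  rw [T.levelAut_hom, S.levelAut_hom, ← CovObj.orbitGraphMap_comp, ← CovObj.orbitGraphMap_comp,
    S.descendBase_comp_eq_comp_descendBase h𝒢 f W htransT hconnT htransS σ.hom σ'.hom hσ]

end Levels

/-! ### Equal base points

A tower of coverings chooses its base vertex-orbits compatibly only up to a propositional equality
(`OVertex.map g W' = W`), realised on `𝒢_{∞,S}` by an `eqToIso` (abc-iut-L3-t9's `baseIso`); these lemmas move
the identification and the action across such an `eqToIso`. -/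

section BaseEq

variable (S : CovObj 𝒢) {c c' : S.orbitGraph.CatCarrier} (h𝒢 : 𝒢.IsCountable)

/-- Changing the base point along an equality commutes with `𝔾̃_S → 𝔾_S`.
[cite: MochizukiSemiAnbd2006, §1 p.15] -/
theorem _root_.Literature.AnabelianGeometry.SemiGraphs.SemiGraph.eqToHom_comp_univCoverProj
    (G : SemiGraph.{u}) {c₀ c₀' : G.CatCarrier} (h : c₀ = c₀') :
    eqToHom (congrArg G.univCover h) ≫ G.univCoverProj c₀' = G.univCoverProj c₀ := by
  subst h
  simp

/-- The identification (B5) is compatible with changing the base point along an equality.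
[cite: MochizukiSemiAnbd2006, Prop 3.6 p.38] -/
theorem CovObj.orbitGraphMap_eqToHom_comp_univCoverOverToUnivCover (h : c = c') :
    CovObj.orbitGraphMap (eqToHom (congrArg (S.univCoverOver · h𝒢) h)) ≫ S.univCoverOverToUnivCover c' h𝒢 =
      S.univCoverOverToUnivCover c h𝒢 ≫ eqToHom (congrArg S.orbitGraph.univCover h) := by
  subst h
  simp [CovObj.orbitGraphMap_id]

/-- The action `autUnivCover` transported across the `eqToIso` of a base-point equality is the
conjugate by the corresponding `eqToHom`s of trees. [cite: MochizukiSemiAnbd2006, Thm 3.7(iii) p.41] -/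
theorem CovObj.autUnivCover_conjAut_eqToIso (h : c = c') (σ : Aut (S.univCoverOver c h𝒢)) :
    (S.autUnivCover c' h𝒢 ((eqToIso (congrArg (S.univCoverOver · h𝒢) h)).conjAut σ)).hom =
      eqToHom (congrArg S.orbitGraph.univCover h).symm ≫ (S.autUnivCover c h𝒢 σ).hom ≫
        eqToHom (congrArg S.orbitGraph.univCover h) := by
  subst h
  simp [Iso.conjAut_apply]

end BaseEq

end ProfiniteSemiGraph

end Literature.AnabelianGeometry.SemiGraphs
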